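import Summits.RiemannHypothesis.RiemannHypothesis.Theorems.JensenLogBandArcLambda3
import HarnessLib

/-!
# `λ‴ = −1/(2s²) + O(1/(Im s)²)` (BAND line, the SHARP input of step S4b)

RH ladder column JENSEN, rung J-P(P3) «log band», BAND crux `XiDerivBandRealAllRates` of route
«JensenLogBand», line «band-one-window» (u-arc reshape), lead rh-jensen-prover g7 — correction of
step (d) of the S4b recipe in HOME/rh-jensen-prover/g7-work/LINE-PLAN.md §8.4/§8.5. RH-FREE
(Γ-factor only). WHAT THIS IS NOT: nothing here bears on zeros of `ζ` or the truth of RH.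

The crude bound `λ‴ = O(1/T)` (`norm_deriv_lamPrime2_add_le`, radius-`1/5` Cauchy estimate) is
NOT enough at the bottom of the band, where `h ≍ T`: the cubic remainder needs
`r³‖D″‖ = O(n)`, i.e. `‖λ‴‖ = O(1/T²)`. Here the Cauchy estimate is run on the LARGE circle of
radius `Im s/4` about `s`, on which `‖λ″(z) − 1/(2z)‖ = O(1/Im s)` by eng-2 g5's Stirling bound
for `ψ′` with a NEGATIVE real-part allowance `m = ⌈Im s/8⌉` (`norm_deriv_digamma_sub_inv_le`):

  `‖λ‴(s) + 1/(2s²)‖ ≤ 12/(Im s)²`  for `Im s ≥ 40` (no hypothesis on `Re s`)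

(`norm_deriv_lamPrime2_add_le_sq`).
-/

noncomputable section

-- single-problem summit: `Summit.RiemannHypothesis.RiemannHypothesis.…` is the tree convention
set_option linter.dupNamespace false

open Complex Real Set Metric

namespace Summit.RiemannHypothesis.RiemannHypothesis.Theorems.JensenPolynomials.LogBandArc

open Literature.NumberTheory.LFunctions

/-- `λ″(z) − 1/(2z) = −1/z² − 1/(z−1)² + ¼(ψ′(z/2) − 1/(z/2))`. [folklore] -/
theorem lamPrime2_sub_eq (z : ℂ) :
    lamPrime2 z - 1 / (2 * z) =
      -1 / z ^ 2 - 1 / (z - 1) ^ 2 + (deriv Complex.digamma (z / 2) - 1 / (z / 2)) / 4 := by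
  rw [lamPrime2]
  rcases eq_or_ne z 0 with h | h
  · subst h; simp
  · field_simp
    ring

/-- **On the upper half-plane, far up:** `‖λ″(z) − 1/(2z)‖ ≤ 32/(9 (Im z)²)·… ≤ 3/Im z` for
`Im z ≥ 30`, WITHOUT any hypothesis on `Re z` (Stirling for `ψ′` with `m = ⌈|Re z|/2⌉`… here in the
form needed on the big Cauchy circle: `Im z ≥ (3/4)Y`, `Re z ≥ −Y/4 − 1`, `Y ≥ 40`). [folklore] -/
theorem norm_lamPrime2_sub_le_far {z : ℂ} {Y : ℝ} (hY : 40 ≤ Y) (hzi : 3 / 4 * Y ≤ z.im)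
    (hzr : -(Y / 4) - 1 ≤ z.re) : ‖lamPrime2 z - 1 / (2 * z)‖ ≤ 139 / 50 / Y := by
  have hY0 : 0 < Y := by linarith
  -- the integer allowance `m = ⌈Y/8 + 1⌉`
  obtain ⟨m, hm1, hm2⟩ : ∃ m : ℕ, Y / 8 + 1 ≤ (m : ℝ) ∧ (m : ℝ) ≤ Y / 8 + 2 := by
    refine ⟨⌈Y / 8 + 1⌉₊, Nat.le_ceil _, ?_⟩
    have := Nat.ceil_lt_add_one (show (0 : ℝ) ≤ Y / 8 + 1 by positivity)
    linarith
  have hw_im : (z / 2).im = z.im / 2 := by simp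
  have hw_re : (z / 2).re = z.re / 2 := by simp
  have hwim2 : 2 ≤ (z / 2).im := by rw [hw_im]; linarith
  have hwre : -(m : ℝ) ≤ (z / 2).re := by rw [hw_re]; linarith
  have hψ := norm_deriv_digamma_sub_inv_le hwim2 m hwre
  rw [hw_im] at hψ
  -- elementary sizes
  have hzim : 0 < z.im := by linarith
  have hz_norm : 3 / 4 * Y ≤ ‖z‖ := hzi.trans ((le_abs_self _).trans (Complex.abs_im_le_norm z))
  have hz1_norm : 3 / 4 * Y ≤ ‖z - 1‖ := by
    have h' := Complex.abs_im_le_norm (z - 1)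
    simp only [Complex.sub_im, Complex.one_im, sub_zero] at h'
    exact hzi.trans ((le_abs_self _).trans h')
  have hA : ‖-1 / z ^ 2‖ ≤ 1 / (3 / 4 * Y) ^ 2 := by
    rw [norm_div, norm_neg, norm_one, norm_pow]
    exact one_div_le_one_div_of_le (by positivity) (pow_le_pow_left₀ (by positivity) hz_norm 2)
  have hB : ‖1 / (z - 1) ^ 2‖ ≤ 1 / (3 / 4 * Y) ^ 2 := by
    rw [norm_div, norm_one, norm_pow]
    exact one_div_le_one_div_of_le (by positivity) (pow_le_pow_left₀ (by positivity) hz1_norm 2)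
  -- the `ψ′` term: (π/4+1)/(Im z/2 − 1) + (m+3)/(Im z/2 − 1)² with Im z/2 − 1 ≥ 3Y/8 − 1 ≥ Y/3
  have hden : Y / 3 ≤ z.im / 2 - 1 := by linarith
  have hden0 : 0 < z.im / 2 - 1 := by linarith
  have hC1 : (Real.pi / 4 + 1) / (z.im / 2 - 1) ≤ (Real.pi / 4 + 1) / (Y / 3) :=
    div_le_div_of_nonneg_left (by positivity) (by positivity) hden
  have hC2 : ((m : ℝ) + 3) / (z.im / 2 - 1) ^ 2 ≤ (Y / 8 + 5) / (Y / 3) ^ 2 := by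
    have h1 : ((m : ℝ) + 3) / (z.im / 2 - 1) ^ 2 ≤ (Y / 8 + 5) / (z.im / 2 - 1) ^ 2 :=
      div_le_div_of_nonneg_right (by linarith) (by positivity)
    exact h1.trans (div_le_div_of_nonneg_left (by positivity) (by positivity)
      (pow_le_pow_left₀ (by positivity) hden 2))
  have hC : ‖(deriv Complex.digamma (z / 2) - 1 / (z / 2)) / 4‖ ≤
      ((Real.pi / 4 + 1) / (Y / 3) + (Y / 8 + 5) / (Y / 3) ^ 2) / 4 := by
    rw [norm_div, Complex.norm_ofNat]
    exact div_le_div_of_nonneg_right (hψ.trans (add_le_add hC1 hC2)) (by norm_num)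
  rw [lamPrime2_sub_eq]
  have hsum := norm_add₃_le (a := -1 / z ^ 2) (b := -(1 / (z - 1) ^ 2))
    (c := (deriv Complex.digamma (z / 2) - 1 / (z / 2)) / 4)
  rw [norm_neg, ← sub_eq_add_neg] at hsum
  refine hsum.trans ?_
  have htot : 1 / (3 / 4 * Y) ^ 2 + 1 / (3 / 4 * Y) ^ 2 +
      ((Real.pi / 4 + 1) / (Y / 3) + (Y / 8 + 5) / (Y / 3) ^ 2) / 4 ≤ 139 / 50 / Y := by
    have e1 : 1 / (3 / 4 * Y) ^ 2 = 16 / 9 * (1 / Y ^ 2) := by field_simp; ring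
    have e2 : (Real.pi / 4 + 1) / (Y / 3) = 3 * (Real.pi / 4 + 1) * (1 / Y) := by field_simp
    have e3 : (Y / 8 + 5) / (Y / 3) ^ 2 = 9 / 8 * (1 / Y) + 45 * (1 / Y ^ 2) := by field_simp; ring
    have e4 : (139 : ℝ) / 50 / Y = 139 / 50 * (1 / Y) := by ring
    rw [e1, e2, e3, e4]
    have hY1 : 0 < 1 / Y := by positivity
    have hY2 : 1 / Y ^ 2 ≤ 1 / 40 * (1 / Y) := by
      rw [show 1 / 40 * (1 / Y) = 1 / (40 * Y) by ring]
      exact one_div_le_one_div_of_le (by positivity) (by nlinarith)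
    have hπY : 3 * (Real.pi / 4 + 1) * (1 / Y) ≤ 54 / 10 * (1 / Y) :=
      mul_le_mul_of_nonneg_right (by linarith [Real.pi_lt_d2]) hY1.le
    have h0 : 0 ≤ 1 / Y ^ 2 := by positivity
    linarith only [hY1, hY2, hπY, h0]
  linarith [hA, hB, hC]

/-- **`λ‴(s) = −1/(2s²) + O(1/(Im s)²)`:** for `Im s ≥ 40` (no hypothesis on `Re s` beyond
`Re s ≥ −1`), `‖deriv λ″ (s) + 1/(2s²)‖ ≤ 12/(Im s)²` — Cauchy's estimate on the circle of radius
`Im s/4`. [folklore] -/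
theorem norm_deriv_lamPrime2_add_le_sq {s : ℂ} (him : 40 ≤ s.im) (hre : -1 ≤ s.re) :
    ‖deriv lamPrime2 s + 1 / (2 * s ^ 2)‖ ≤ 12 / s.im ^ 2 := by
  set Y : ℝ := s.im with hY
  set R : ℝ := Y / 4 with hR
  have hY0 : 0 < Y := by linarith
  have hR0 : 0 < R := by positivity
  set g : ℂ → ℂ := fun z => lamPrime2 z - 1 / (2 * z) with hg
  have hU : IsOpen {z : ℂ | 0 < z.im} := isOpen_lt continuous_const Complex.continuous_im
  have hgdiff : DifferentiableOn ℂ g {z : ℂ | 0 < z.im} := by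
    refine differentiableOn_lamPrime2.sub ?_
    intro z hz
    have hz' : 0 < z.im := hz
    have hz0 : z ≠ 0 := fun h => by rw [h] at hz'; simp at hz'
    exact ((differentiableAt_const _).div (differentiableAt_id.const_mul 2)
      (mul_ne_zero two_ne_zero hz0)).differentiableWithinAt
  have hball : ∀ z, ‖z - s‖ ≤ R → 3 / 4 * Y ≤ z.im ∧ -(Y / 4) - 1 ≤ z.re := by
    intro z hz
    have hzi : |(z - s).im| ≤ R := le_trans (Complex.abs_im_le_norm _) hz
    have hzr : |(z - s).re| ≤ R := le_trans (Complex.abs_re_le_norm _) hz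
    rw [Complex.sub_im, abs_le] at hzi
    rw [Complex.sub_re, abs_le] at hzr
    constructor <;> [linarith [hzi.1]; linarith [hzr.1]]
  have hsub : closedBall s R ⊆ {z : ℂ | 0 < z.im} := by
    intro z hz
    have := (hball z (mem_closedBall_iff_norm.1 hz)).1
    show 0 < z.im
    linarith
  have hdc : DiffContOnCl ℂ g (ball s R) := by
    refine DifferentiableOn.diffContOnCl ?_
    rw [closure_ball s hR0.ne']
    exact hgdiff.mono hsub
  have hC : ∀ z ∈ sphere s R, ‖g z‖ ≤ 139 / 50 / Y := by
    intro z hz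
    obtain ⟨hzi, hzr⟩ := hball z (mem_sphere_iff_norm.1 hz).le
    exact norm_lamPrime2_sub_le_far (by linarith) hzi hzr
  have hest := Complex.norm_deriv_le_of_forall_mem_sphere_norm_le hR0 hdc hC
  -- `deriv g s = deriv λ″ s + 1/(2 s²)`
  have hsim : 0 < s.im := by linarith
  have hs0 : s ≠ 0 := fun h => by rw [h] at hsim; simp at hsim
  have hL : DifferentiableAt ℂ lamPrime2 s := (differentiableOn_lamPrime2 s hsim).differentiableAt
    (hU.mem_nhds hsim)
  have hinv : HasDerivAt (fun z : ℂ => 1 / (2 * z)) (-(1 / (2 * s ^ 2))) s := by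
    have h1 : HasDerivAt (fun z : ℂ => (2 * z)⁻¹) (-(2 * 1) / (2 * s) ^ 2) s := by
      have := ((hasDerivAt_id s).const_mul (2 : ℂ)).fun_inv (mul_ne_zero two_ne_zero hs0)
      simpa using this
    refine (h1.congr_of_eventuallyEq (Filter.Eventually.of_forall fun z => by simp [one_div])).congr_deriv ?_
    field_simp
  have hderiv : deriv g s = deriv lamPrime2 s + 1 / (2 * s ^ 2) := by
    have h1 : HasDerivAt g (deriv lamPrime2 s - -(1 / (2 * s ^ 2))) s := hL.hasDerivAt.sub hinv
    rw [h1.deriv]; ring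
  rw [hderiv] at hest
  calc ‖deriv lamPrime2 s + 1 / (2 * s ^ 2)‖ ≤ 139 / 50 / Y / R := hest
    _ = 278 / 25 / Y ^ 2 := by rw [hR]; field_simp; ring
    _ ≤ 12 / s.im ^ 2 := by rw [hY]; exact div_le_div_of_nonneg_right (by norm_num) (by positivity)

end Summit.RiemannHypothesis.RiemannHypothesis.Theorems.JensenPolynomials.LogBandArc

end
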